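import Mathlib.CategoryTheory.Adjunction.Unique
import Mathlib.CategoryTheory.Subobject.Lattice
import Literature.AnabelianGeometry.SemiGraphs.FiniteEtaleCoveringIdentity
import Literature.AnabelianGeometry.SemiGraphs.Coverticial
import Literature.AnabelianGeometry.SemiGraphs.DecompositionGroupGeneral
import Literature.AnabelianGeometry.Anabelioids.TerminalCoproductComponents
import HarnessLib

/-!
# The identity 1-morphism is a finite étale covering in print's sense: the local description, the
# four-clause covering notion, and "universally sub-coverticial ⇒ sub-coverticial"
# ([SemiAnbd] §2, Def. 2.2 (i) p. 23, Def. 2.4 (iii) pp. 25–26)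

Mochizuki, *Semi-graphs of anabelioids*, Publ. RIMS **42** (2006) 221–322, §2: Definition 2.2 (i)
p. 23 (the finite étale covering attached to an object `G'` of `B(𝒢)`; for `G'` terminal the covering
is `𝒢` itself: every `S_v`, `T_e` is a terminal — hence connected — object, so the vertices and edges
of `𝒢'` "correspond bijectively to" those of `𝒢` and every constituent `(𝒢_v)_P` is `𝒢_v`), and
Definition 2.4 (iii) pp. 25–26 (sub-coverticial / universally sub-coverticial edges: the latter
quantifies over "every finite étale covering `𝒢'' → 𝒢`", in particular over the identity covering).
[cite: MochizukiSemiAnbd2006, Def. 2.2(i) p.23] [cite: MochizukiSemiAnbd2006, Def. 2.4(iii) p.25]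

abc-iut cell, block F (FACT-LIST rows F-1492 / F-1493 / F-2531, seat abc-iut-f-005), companion of
`FiniteEtaleCoveringIdentity.lean` (global clause, branch and vertex alignment of `Hom.id 𝒢`).
PROOF-ONLY file (no `def`):

* `exists_equivalence_star_of_isTerminal` — pure category theory: for `P` terminal,
  `forget P : C_{/P} ⥤ C` is an equivalence with `𝟭 ≅ (P × −) ⋙ forget P`;
* `isConnected_of_isTerminal`, `isConnected_top_of_isTerminal`, `subsingleton_π₀Obj_of_isTerminal` —
  a terminal object of a connected anabelioid is connected with exactly one connected component, `⊤`;
* `preservesTerminal_ρE`, `hasTerminal_bObj` — `ρ_e` preserves, and `B(𝒢)` has, terminal objects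
  (limits in `B(𝒢)` are componentwise, `hasLimitsOfShape_bObj`);
* `Hom.id_isFiniteEtaleCoveringOf (hA : IsTerminal A) : (Hom.id 𝒢).IsFiniteEtaleCoveringOf A` — the
  LOCAL description of Def. 2.2 (i) for the identity and a terminal object (component functions
  `v ↦ ⊤`, `e ↦ ⊤`; `α := forget ⊤`; the gluing condition through `ψ_b`);
* `Hom.id_isFiniteEtaleCoveringGlobal : (Hom.id 𝒢).IsFiniteEtaleCoveringGlobal` — the identity is a
  finite étale covering in print's four-clause sense (local ∧ global ∧ branch-aligned ∧
  vertex-aligned, `Coverticial.lean`), at `A := ⊤_ B(𝒢)`;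
* `IsUniversallySubCoverticial.isSubCoverticial`,
  `IsTotallyUniversallySubCoverticial.isTotallySubCoverticial` — the implication of Def. 2.4 (iii)
  implicit in print, by applying "for every finite étale covering" to the identity covering.

Nothing here takes a side on [IUTchIII] Cor. 3.12; a FACT row is an assumption label; proved = OUR
kernel check only.
-/

namespace Literature.AnabelianGeometry.SemiGraphs

open CategoryTheory CategoryTheory.Limits CategoryTheory.Functor CategoryTheory.PreGaloisCategory
open Literature.AnabelianGeometry.Anabelioids

universe v₁ u₁ u

/-! ### A. Generic: slices over a terminal object; components of a terminal object -/

section Generic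

variable {C : Type*} [Category C]

/-- For `P` terminal in a category with binary products, `forget P : C_{/P} ⥤ C` is an equivalence
and `𝟭 ≅ (P × −) ⋙ forget P` — by uniqueness of the right adjoint of `forget P` (`forget ⊣ star`
versus the adjoint equivalence `Over.equivalenceOfIsTerminal`).  This is the shape of the local and
global clauses of [SemiAnbd] Def. 2.2 (i) for a terminal component. [cite: MochizukiSemiAnbd2006, Def. 2.2(i) p.23] -/
theorem exists_equivalence_star_of_isTerminal [HasBinaryProducts C] {P : C} (hP : IsTerminal P) :
    ∃ α : Over P ⥤ C, α.IsEquivalence ∧ Nonempty (𝟭 C ≅ Over.star P ⋙ α) := by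
  let e : Over P ≌ C := Over.equivalenceOfIsTerminal hP
  let i : Over.star P ≅ e.inverse := (Over.forgetAdjStar P).rightAdjointUniq e.toAdjunction
  exact ⟨e.functor, e.isEquivalence_functor,
    ⟨e.counitIso.symm ≪≫ Functor.isoWhiskerRight i.symm e.functor⟩⟩

variable [GaloisCategory C]

/-- A terminal object of a connected anabelioid is connected. [cite: SGA1, Exp. V §5] -/
theorem isConnected_of_isTerminal {X : C} (hX : IsTerminal X) : IsConnected X :=
  haveI : IsConnected (⊤_ C) := isConnected_terminal
  isConnected_of_iso (terminalIsTerminal.uniqueUpToIso hX)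

/-- The top subobject of a terminal object of a connected anabelioid is a connected component.
[cite: MochizukiSemiAnbd2006, Def. 2.2(i) p.23] -/
theorem isConnected_top_of_isTerminal {X : C} (hX : IsTerminal X) :
    IsConnected ((⊤ : Subobject X) : C) :=
  haveI : IsConnected X := isConnected_of_isTerminal hX
  isConnected_of_iso (asIso (⊤ : Subobject X).arrow).symm

/-- A terminal object of a connected anabelioid has at most one connected component (every connected
subobject is `⊤`). [cite: MochizukiSemiAnbd2006, Def. 2.2(i) p.23] -/
theorem subsingleton_π₀Obj_of_isTerminal {X : C} (hX : IsTerminal X) : Subsingleton (π₀Obj X) := by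
  haveI : IsConnected X := isConnected_of_isTerminal hX
  refine ⟨fun P Q => Subtype.ext ?_⟩
  have hP : P.1 = ⊤ := by
    haveI : IsIso P.1.arrow :=
      IsConnected.noTrivialComponent _ P.1.arrow (fun h => P.2.notInitial h)
    exact Subobject.eq_top_of_isIso_arrow _
  have hQ : Q.1 = ⊤ := by
    haveI : IsIso Q.1.arrow :=
      IsConnected.noTrivialComponent _ Q.1.arrow (fun h => Q.2.notInitial h)
    exact Subobject.eq_top_of_isIso_arrow _
  rw [hP, hQ]

end Generic

namespace SemiGraphOfAnabelioids

variable {𝒢 : SemiGraphOfAnabelioids.{v₁, u₁, u}}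

/-! ### B. The local description of Def. 2.2 (i) for the identity -/

/-- The restriction functors `ρ_e : B(𝒢) ⥤ 𝒢_e` preserve terminal objects (limits in `B(𝒢)` are
componentwise). [cite: MochizukiSemiAnbd2006, Def. 2.1 p.23] -/
theorem preservesTerminal_ρE (𝒢 : SemiGraphOfAnabelioids.{v₁, u₁, u}) (e : 𝒢.graph.Edge) :
    PreservesLimitsOfShape (Discrete PEmpty.{1}) (𝒢.ρE e) := by
  haveI : ∀ (b : 𝒢.graph.Branch) (v : 𝒢.graph.Vertex) (h : 𝒢.graph.abuts b = some v),
      PreservesLimitsOfShape (Discrete PEmpty.{1}) (𝒢.pull b v h).pullback := fun b v h => by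
    haveI : PreservesFiniteLimits (𝒢.pull b v h).pullback := (𝒢.pull b v h).property.1
    infer_instance
  exact (𝒢.hasLimitsOfShape_bObj (J := Discrete PEmpty.{1})).2.2 e

/-- `B(𝒢)` has a terminal object (limits in `B(𝒢)` are componentwise).
[cite: MochizukiSemiAnbd2006, Def. 2.1 p.23] -/
theorem hasTerminal_bObj (𝒢 : SemiGraphOfAnabelioids.{v₁, u₁, u}) : HasTerminal 𝒢.BObj := by
  haveI : ∀ (b : 𝒢.graph.Branch) (v : 𝒢.graph.Vertex) (h : 𝒢.graph.abuts b = some v),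
      PreservesLimitsOfShape (Discrete PEmpty.{1}) (𝒢.pull b v h).pullback := fun b v h => by
    haveI : PreservesFiniteLimits (𝒢.pull b v h).pullback := (𝒢.pull b v h).property.1
    infer_instance
  exact (𝒢.hasLimitsOfShape_bObj (J := Discrete PEmpty.{1})).1

/-- **The identity 1-morphism is LOCALLY the covering attached to a terminal object `A` of `B(𝒢)`**
([SemiAnbd] Def. 2.2 (i) for `G' = ⊤`): the identity of the underlying semi-graph is proper; every
`A_v`, `A_e` is terminal, hence has exactly one connected component `⊤`, so `v ↦ (v, ⊤)`, `e ↦ (e, ⊤)`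
are bijections onto the components; the constituent morphisms `id_v^* = 𝟭 ≅ (⊤ × −) ⋙ forget ⊤` are
the component coverings; and the component `⊤ ⊆ A_e` lies under `b^* ⊤ ⊆ b^* A_v ⥲ A_e` through
`ψ_b⁻¹`. [cite: MochizukiSemiAnbd2006, Def. 2.2(i) p.23] -/
theorem Hom.id_isFiniteEtaleCoveringOf {A : 𝒢.BObj} (hA : IsTerminal A) :
    (Hom.id 𝒢).IsFiniteEtaleCoveringOf A := by
  -- the vertex and edge objects of `A` are terminal
  have hS : ∀ v : 𝒢.graph.Vertex, IsTerminal (A.S v) := fun v => by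
    haveI := preservesTerminal_ρ 𝒢 v
    exact hA.isTerminalObj (𝒢.ρ v) A
  have hT : ∀ e : 𝒢.graph.Edge, IsTerminal (A.T e) := fun e => by
    haveI := preservesTerminal_ρE 𝒢 e
    exact hA.isTerminalObj (𝒢.ρE e) A
  haveI hSs : ∀ v : 𝒢.graph.Vertex, Subsingleton (π₀Obj (A.S v)) :=
    fun v => subsingleton_π₀Obj_of_isTerminal (hS v)
  haveI hTs : ∀ e : 𝒢.graph.Edge, Subsingleton (π₀Obj (A.T e)) :=
    fun e => subsingleton_π₀Obj_of_isTerminal (hT e)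
  -- component functions: the top subobjects
  let cV : ∀ v : 𝒢.graph.Vertex, π₀Obj (A.S ((Hom.id 𝒢).base.vertexMap v)) :=
    fun v => ⟨⊤, isConnected_top_of_isTerminal (hS v)⟩
  let cE : ∀ e : 𝒢.graph.Edge, π₀Obj (A.T ((Hom.id 𝒢).base.edgeMap e)) :=
    fun e => ⟨⊤, isConnected_top_of_isTerminal (hT e)⟩
  refine ⟨fun _ => rfl, cV, cE, ?_, ?_, ?_, ?_, ?_⟩
  · -- vertices ↔ components of the `A_v`
    refine ⟨fun v₁ v₂ h => congrArg Sigma.fst h, fun ⟨v, P⟩ => ⟨v, ?_⟩⟩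
    exact Sigma.ext rfl (heq_of_eq (Subsingleton.elim _ _))
  · -- edges ↔ components of the `A_e`
    refine ⟨fun e₁ e₂ h => congrArg Sigma.fst h, fun ⟨e, P⟩ => ⟨e, ?_⟩⟩
    exact Sigma.ext rfl (heq_of_eq (Subsingleton.elim _ _))
  · -- vertex constituents: `id_v^* = 𝟭 ≅ (⊤ × −) ⋙ forget ⊤`
    intro v
    exact exists_equivalence_star_of_isTerminal
      ((hS v).ofIso (asIso (⊤ : Subobject (A.S v)).arrow).symm)
  · -- edge constituents
    intro e
    exact exists_equivalence_star_of_isTerminal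
      ((hT e).ofIso (asIso (⊤ : Subobject (A.T e)).arrow).symm)
  · -- the gluing condition: `⊤ ⊆ A_e` factors through `b^* ⊤ ↪ b^* A_v ⥲ A_e`
    intro b v h
    refine ⟨(⊤ : Subobject (A.T (𝒢.graph.edgeOf b))).arrow ≫ (A.ψ b v h).inv ≫
      (𝒢.pull b v h).pullback.map (asIso (⊤ : Subobject (A.S v)).arrow).inv, ?_⟩
    change ((⊤ : Subobject (A.T (𝒢.graph.edgeOf b))).arrow ≫ (A.ψ b v h).inv ≫
        (𝒢.pull b v h).pullback.map (asIso (⊤ : Subobject (A.S v)).arrow).inv) ≫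
      ((𝒢.pull b v h).pullback.map (asIso (⊤ : Subobject (A.S v)).arrow).hom ≫ (A.ψ b v h).hom) ≫
        𝟙 (A.T (𝒢.graph.edgeOf b)) = (⊤ : Subobject (A.T (𝒢.graph.edgeOf b))).arrow
    simp only [Category.comp_id, Category.assoc]
    rw [← Functor.map_comp_assoc, Iso.inv_hom_id, CategoryTheory.Functor.map_id, Category.id_comp,
      Iso.inv_hom_id, Category.comp_id]

/-! ### C. The identity is a finite étale covering in print's four-clause sense -/

/-- **The identity 1-morphism `𝒢 → 𝒢` is a finite étale covering of `𝒢` in print's sense**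
(`Hom.IsFiniteEtaleCoveringGlobal` = local ∧ global ∧ branch-aligned ∧ vertex-aligned, at the
terminal object `A := ⊤_ B(𝒢)`): [SemiAnbd] Def. 2.2 (i) for `G' = ⊤` — the unit of Rmk. 2.4.2's
"morphisms form a category" at the level of coverings. [cite: MochizukiSemiAnbd2006, Def. 2.2(i) p.23] -/
theorem Hom.id_isFiniteEtaleCoveringGlobal : (Hom.id 𝒢).IsFiniteEtaleCoveringGlobal := by
  haveI := hasTerminal_bObj 𝒢
  exact ⟨⊤_ 𝒢.BObj, Hom.id_isFiniteEtaleCoveringOf terminalIsTerminal,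
    Hom.id_isGlobalCoveringOf terminalIsTerminal, Hom.id_isBranchAligned, Hom.id_isVertexAligned⟩

/-! ### D. Def. 2.4 (iii): universally sub-coverticial edges are sub-coverticial -/

variable (𝒢) in
/-- **A universally sub-coverticial edge is sub-coverticial** ([SemiAnbd] Def. 2.4 (iii): "for every
finite étale covering `𝒢'' → 𝒢` … every edge `e''` … that maps to `e` is sub-coverticial" applied to
the identity covering `𝒢 → 𝒢` and `e'' := e`). [cite: MochizukiSemiAnbd2006, Def. 2.4(iii) p.25] -/
theorem IsUniversallySubCoverticial.isSubCoverticial {e : 𝒢.graph.Edge}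
    (h : 𝒢.IsUniversallySubCoverticial e) : 𝒢.IsSubCoverticial e :=
  h.2 𝒢 (Hom.id 𝒢) Hom.id_isFiniteEtaleCoveringGlobal e rfl

variable (𝒢) in
/-- **A totally universally sub-coverticial semi-graph of anabelioids is totally sub-coverticial**
([SemiAnbd] Def. 2.4 (iii), edgewise by `IsUniversallySubCoverticial.isSubCoverticial`).
[cite: MochizukiSemiAnbd2006, Def. 2.4(iii) p.26] -/
theorem IsTotallyUniversallySubCoverticial.isTotallySubCoverticial
    (h : 𝒢.IsTotallyUniversallySubCoverticial) : 𝒢.IsTotallySubCoverticial :=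
  ⟨fun e he => (h.isUniversallySubCoverticial e he).isSubCoverticial⟩

end SemiGraphOfAnabelioids

end Literature.AnabelianGeometry.SemiGraphs
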